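import Summits.Parity.GeneralizedHardyLittlewood.Theorems.LeeYangFibresRelativeDimOneDefs
import HarnessLib

/-!
# Route `LeeYangFibres`, crux `AbsoluteUpgrade` (stmt-Parity-14116): vocabulary of the line `Sketch`
# reshaped as the UNIFORM AMPLIFICATION skeleton (lead seat c10)

Route-posited objects and statement types (D-0016 `<Route><Crux>Defs` file) shared by the registered stubs of the
reshaped skeleton `Cruxes/AbsoluteUpgrade/Lines/Sketch.lean` and by the Theorems files that prove them. NOTHING IS
ASSERTED: every `def … : Prop` below is a *statement* — the type of a registered stub — consumed only as the type
of a stub theorem or as an explicit hypothesis.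

THE LINE (strategist census `Cruxes/AbsoluteUpgrade/STRATEGY-CENSUS.md` §2.3 / S2, "door (b)"). `AbsoluteUpgrade :=
RelativeDimOne → DimOne`. The one genuinely non-linear use of RELATIVE accuracy found for this crux is the tensor-power
trick over translate-constellations (vocabulary `Cruxes.RelativeDimOne.TranslateAmplification`: `translateFamily Ψ H`,
`meetTranslates K H`, `shiftBox m N`, the PROVED complete-sum identity `completeSum`): if relative
Dickson–Hardy–Littlewood held UNIFORMLY in the number of forms `T ≤ (log log N)^A` (`UniformRelativeDimOne`, S⁺ —
the conjectural residual of the line, at least as strong as the crux), then summing it over the `(m+1)`-fold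
translates with `m + 1 ≍ (log log N)^{t-1}` and extracting `(m+1)`-th roots divides the relative error by `m+1`,
which beats the maximal singular mass `sup_Ψ ∏_p β_p ≍ (log log N)^{t-1}` and gives the ABSOLUTE statement `DimOne`
(`Amplification`). The provable heart is Gallagher's averaging of the main terms UNIFORMLY IN `m`
(`UniformSingularMean`): the landed `SingularMean` (p-ids in `Theorems/LeeYangFibresRelativeDimOneEquivalence`) is
for fixed `m`; uniformity in `m + 1 ≤ (log log N)^A` needs an AVERAGED treatment of the collision primes `p > y_N`
(the primes at which two translated roots coincide), which is what the stubs below organise: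

* `LocalRatioFacts` (A): at a prime `p > y` every form of a `d = 1` system has one root; the local factor of the
  translate-constellation is `β_p(Ψ)^{m+1} · r_p · (1 + d_p(H)/(p − (m+1)ν_p))` with the generic ratio
  `r_p = genericRatio m ν_p p ∈ (0, 1]`, `1 − r_p ≤ ((m+1)ν_p/p)²`, and the defect `0 ≤ d_p(H) ≤ collisionCount Ψ H p`
  (Bonferroni: the union of the `m+1` translated root sets loses at most one residue per coincidence, and a
  coincidence of the roots of `ψ_i(· + H'_j)` and `ψ_{i'}(· + H'_{j'})` means `p ∣ collisionForm Ψ H j j' i i'`).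
* `CondLocalAverage` (B): the exact Chinese-remainder average of `∏_{p ∈ S} β_p(Ψ^{(H)})` times a product of
  collision conditions `p ∣ Δ_{α(p)}(H)` at further primes `p ∈ Q` over a box of side `∏_{S ∪ Q} p`:
  `= (∏_{S∪Q} p)^m (∏_{p∈S} β_p(Ψ)^{m+1}) / ∏_Q p` (one linear condition per prime of `Q`).
* `CollisionFormFacts` (C): explicit degenerate count `≤ m(m+1)t²(4N+1)^{m-1}`, non-vanishing of the collision
  forms of a non-degenerate translate-constellation, and their size `≤ 6L²N` on the shift box.
* `MediumCollisions` (D1): the contribution of the square-free collision moduli `q ≤ √N` (cubes of side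
  `primorial(y) · q ≤ N`, the landed cube lemma `shiftBox_sum_mul_sub_le`, Mertens' `∑_{p ≤ √N} 1/p ≤ log log N + 4`).
* `TailCollisions` (D2): the moduli `q > √N`, pointwise in a non-degenerate shift by Rankin's trick with exponent
  `1/2` (a non-zero collision form of size `≤ 6L²N` has `≤ log(6L²N)/log y` prime factors `> y`).
* `UniformSingularMeanGlue` (E): A, C, D1, D2 ⟹ `UniformSingularMean` (finite truncation `x`, then `x → ∞`).
* `Amplification` (F): `UniformSingularMean → CollisionFormFacts → UniformRelativeDimOne → DimOne`.

References: P. X. Gallagher, Mathematika 23 (1976), §2 [Gallagher1976]; B. Green, T. Tao, Ann. of Math. 171 (2010),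
Conj. 1.2 / Conj. 1.4 and Lemma 1.3 [GreenTao2010]; T. Tao, V. Vu, *Additive Combinatorics*, §2 (tensor power trick).
-/

noncomputable section

open scoped BigOperators Classical Topology
open Finset Filter MeasureTheory Literature.NumberTheory.Sieve
open Summit.Parity.GeneralizedHardyLittlewood.Theses.LeeYangFibres (RelativeDimOne DimOne)
open Summit.Parity.GeneralizedHardyLittlewood.Cruxes.RelativeDimOne.TranslateAmplification

namespace Summit.Parity.GeneralizedHardyLittlewood.Cruxes.AbsoluteUpgrade.UniformAmplification

variable {t m : ℕ}

/-! ### Objects -/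

/-- The COLLISION FORM `Δ_{j,j',i,i'}(H) = a_i a_{i'} (H'_j − H'_{j'}) + (a_{i'} b_i − a_i b_{i'})` of the pair of
translated forms `ψ_i(· + H'_j)`, `ψ_{i'}(· + H'_{j'})` (`ψ_i(n) = a_i n + b_i`, `H' = shiftVec H`): a prime `p ∤ a_i a_{i'}`
divides it iff the two forms have the same root modulo `p`; it vanishes iff the two forms are proportional
(`exists_hyperplane_of_degenerate`). [folklore] -/
def collisionForm (Ψ : Fin t → AffLinForm 1) (H : Fin m → ℤ) (j j' : Fin (m + 1)) (i i' : Fin t) : ℤ :=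
  (Ψ i).coeff 0 * (Ψ i').coeff 0 * (shiftVec H j - shiftVec H j') +
    ((Ψ i').coeff 0 * (Ψ i).const - (Ψ i).coeff 0 * (Ψ i').const)

/-- The index set of ordered collision pairs `((j, j'), (i, i'))`. [folklore] -/
abbrev CollisionIndex (m t : ℕ) : Type := (Fin (m + 1) × Fin (m + 1)) × (Fin t × Fin t)

/-- The COLLISION COUNT of the shift `H` at the modulus `p`: the number of ordered index pairs `((j,j'),(i,i'))`
with `j ≠ j'` and `p ∣ Δ_{j,j',i,i'}(H)`. [folklore] -/
def collisionCount (Ψ : Fin t → AffLinForm 1) (H : Fin m → ℤ) (p : ℕ) : ℕ :=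
  #{x : CollisionIndex m t | x.1.1 ≠ x.1.2 ∧ (p : ℤ) ∣ collisionForm Ψ H x.1.1 x.1.2 x.2.1 x.2.2}

/-- The collision count never exceeds the number of index pairs, `(m+1)² t²` (registered sub-goal of this
vocabulary file). [folklore] -/
theorem collisionCount_le : ∀ {t m : ℕ} (Ψ : Fin t → AffLinForm 1) (H : Fin m → ℤ) (p : ℕ), collisionCount Ψ H p ≤ (m + 1) ^ 2 * t ^ 2 := by
  intro t m Ψ H p
  unfold collisionCount
  calc #{x : CollisionIndex m t | x.1.1 ≠ x.1.2 ∧ (p : ℤ) ∣ collisionForm Ψ H x.1.1 x.1.2 x.2.1 x.2.2}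
      ≤ #(Finset.univ : Finset (CollisionIndex m t)) := Finset.card_filter_le _ _
    _ = (m + 1) ^ 2 * t ^ 2 := by
        rw [Finset.card_univ]
        simp only [Fintype.card_prod, Fintype.card_fin]
        ring

/-- `ν_p(Φ)`: the number of residues `c mod p` at which some form of the one-dimensional system `Φ` vanishes
modulo `p` (so that `β_p(Φ) = (p/(p−1))^T (1 − ν_p(Φ)/p)` for a prime `p`). [cite: GreenTao2010, (1.6)] -/
def rootClassCount {T : ℕ} (Φ : Fin T → AffLinForm 1) (p : ℕ) : ℕ :=
  #{c ∈ Finset.range p | ∃ i, (p : ℤ) ∣ (Φ i).eval fun _ => (c : ℤ)}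

/-- The GENERIC RATIO `r_p = (p − (m+1)ν) p^m / (p − ν)^{m+1} = (1 − (m+1)ν/p)/(1 − ν/p)^{m+1}`: the value of
`β_p(Ψ^{(H)})/β_p(Ψ)^{m+1}` at a prime `p` where the `m+1` translated root sets are pairwise disjoint. [folklore] -/
def genericRatio (m ν p : ℕ) : ℝ :=
  ((p : ℝ) - (m + 1) * ν) * (p : ℝ) ^ m / ((p : ℝ) - ν) ^ (m + 1)

/-- The primes of the window `(y, x]`. [folklore] -/
def primeWindow (y x : ℕ) : Finset ℕ := (Finset.Ioc y x).filter Nat.Prime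

/-! ### Statements (types of the registered stubs; nothing is asserted here) -/

/-- **S⁺ = `UniformRelativeDimOne`** (the line's conjectural residual; census S2, verbatim the strategist's typing).
`RelativeDimOne` (Green–Tao Conj. 1.4 error shape `ε(β_∞∏β_p + N)`) required UNIFORMLY in the number of forms
`t ≤ (log log N)^A`, for every `A`, with the size bound scaled per form (`affLinSize Ψ N ≤ L·t`). Relative accuracy
only — no rate in `N`. At least as strong as the crux (it implies `DimOne` by `Amplification`; census S2(b)). (References in the module docstring.) -/
def UniformRelativeDimOne : Prop :=
  ∀ (A L : ℕ), ∀ ε : ℝ, 0 < ε → ∃ N₀ : ℕ, ∀ N : ℕ, N₀ ≤ N → ∀ t : ℕ, 1 ≤ t →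
    (t : ℝ) ≤ Real.log (Real.log N) ^ A → ∀ Ψ : Fin t → AffLinForm 1,
      IsNondegenerateSystem Ψ → affLinSize Ψ N ≤ L * t → ∀ K : Set (Fin 1 → ℝ), Convex ℝ K →
        K ⊆ realBox 1 N →
          |vonMangoldtSum Ψ K N - archFactor Ψ K * singularProduct Ψ| ≤
            ε * (archFactor Ψ K * singularProduct Ψ + N)

/-- **`UniformSingularMean`** (m-UNIFORM Gallagher averaging for translate-constellations): the landed `SingularMean`
with the number of translates quantified AFTER the scale, `(m+1) t ≤ (log log N)^A` — the main terms
`M_H = β_∞(Ψ^{(H)}, K_H) 𝔖(Ψ^{(H)})` of the non-degenerate translate-constellations sum to `(β_∞(Ψ,K) 𝔖(Ψ))^{m+1}` up to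
`ε ((β_∞ 𝔖)^{m+1} + N^{m+1})`. (References in the module docstring.) -/
def UniformSingularMean : Prop :=
  ∀ (t L A : ℕ), 1 ≤ t → ∀ ε : ℝ, 0 < ε → ∃ N₀ : ℕ, ∀ N : ℕ, N₀ ≤ N → ∀ m : ℕ,
    (((m + 1) * t : ℕ) : ℝ) ≤ Real.log (Real.log N) ^ A →
    ∀ Ψ : Fin t → AffLinForm 1, IsNondegenerateSystem Ψ → affLinSize Ψ N ≤ L →
      ∀ K : Set (Fin 1 → ℝ), Convex ℝ K → K ⊆ realBox 1 N →
        |∑ H ∈ (shiftBox m N).filter (fun H => IsNondegenerateSystem (translateFamily Ψ H)),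
              archFactor (translateFamily Ψ H) (meetTranslates K H) *
                singularProduct (translateFamily Ψ H)
            - (archFactor Ψ K * singularProduct Ψ) ^ (m + 1)| ≤
          ε * ((archFactor Ψ K * singularProduct Ψ) ^ (m + 1) + (N : ℝ) ^ (m + 1))

/-- **A = `LocalRatioFacts`** (the local factor of a translate-constellation at a prime not dividing the leading
coefficients). (1) the exact `d = 1` formula `β_p(Φ) = (p/(p−1))^T (1 − ν_p(Φ)/p)`; (2) union bound
`ν_p(Ψ^{(H)}) ≤ (m+1) ν_p(Ψ)`; (3) Bonferroni `(m+1) ν_p(Ψ) ≤ ν_p(Ψ^{(H)}) + collisionCount Ψ H p`; (4) `1 ≤ ν_p(Ψ) ≤ t`;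
(5) the generic ratio: `0 < r ≤ 1` and `1 − r ≤ ((m+1)ν/p)²` when `2(m+1)ν ≤ p`. (References in the module docstring.) -/
def LocalRatioFacts : Prop :=
  (∀ (T p : ℕ) (Φ : Fin T → AffLinForm 1), p.Prime →
      localFactor Φ p = ((p : ℝ) / ((p : ℝ) - 1)) ^ T * (1 - (rootClassCount Φ p : ℝ) / p)) ∧
  (∀ (t m p : ℕ) (Ψ : Fin t → AffLinForm 1) (H : Fin m → ℤ), p.Prime →
      (∀ i, ¬ (p : ℤ) ∣ (Ψ i).coeff 0) →
        rootClassCount (translateFamily Ψ H) p ≤ (m + 1) * rootClassCount Ψ p) ∧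
  (∀ (t m p : ℕ) (Ψ : Fin t → AffLinForm 1) (H : Fin m → ℤ), p.Prime →
      (∀ i, ¬ (p : ℤ) ∣ (Ψ i).coeff 0) →
        (m + 1) * rootClassCount Ψ p ≤ rootClassCount (translateFamily Ψ H) p + collisionCount Ψ H p) ∧
  (∀ (t p : ℕ) (Ψ : Fin t → AffLinForm 1), p.Prime → (∀ i, ¬ (p : ℤ) ∣ (Ψ i).coeff 0) → 1 ≤ t →
      1 ≤ rootClassCount Ψ p ∧ rootClassCount Ψ p ≤ t) ∧
  (∀ (m ν p : ℕ), 0 < p → 2 * ((m + 1) * ν) ≤ p →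
      0 < genericRatio m ν p ∧ genericRatio m ν p ≤ 1 ∧
        1 - genericRatio m ν p ≤ (((m + 1) * ν : ℕ) : ℝ) ^ 2 / (p : ℝ) ^ 2)

/-- **B = `CondLocalAverage`** (exact Chinese-remainder average with collision conditions): for disjoint finite sets of
primes `S`, `Q`, an assignment `α` of a collision index with distinct translate indices to every prime of `Q`
(primes of `Q` not dividing the leading coefficients), and any integer box of side `∏_{S ∪ Q} p`:
`∑_{H ∈ box} (∏_{p ∈ S} β_p(Ψ^{(H)})) · ∏_{p ∈ Q} 1[p ∣ Δ_{α(p)}(H)] = (∏_{S∪Q} p)^m (∏_{p ∈ S} β_p(Ψ)^{m+1}) / ∏_Q p`.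
(`Q = ∅` is the landed `LocalAverage`; each condition fixes one coordinate or one difference of coordinates modulo
`p`, `p^{m-1}` solutions.) (References in the module docstring.) -/
def CondLocalAverage : Prop :=
  ∀ (m t : ℕ) (Ψ : Fin t → AffLinForm 1) (S Q : Finset ℕ), (∀ p ∈ S, p.Prime) → (∀ p ∈ Q, p.Prime) →
    Disjoint S Q → ∀ α : ℕ → CollisionIndex m t, (∀ p ∈ Q, (α p).1.1 ≠ (α p).1.2) →
      (∀ p ∈ Q, ∀ i, ¬ (p : ℤ) ∣ (Ψ i).coeff 0) → ∀ a : Fin m → ℤ,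
        ∑ H ∈ Fintype.piFinset (fun j : Fin m => Finset.Ico (a j) (a j + ∏ p ∈ S ∪ Q, (p : ℤ))),
            (∏ p ∈ S, localFactor (translateFamily Ψ H) p) *
              ∏ p ∈ Q, (if (p : ℤ) ∣ collisionForm Ψ H (α p).1.1 (α p).1.2 (α p).2.1 (α p).2.2
                then (1 : ℝ) else 0)
          = ((∏ p ∈ S ∪ Q, p : ℕ) : ℝ) ^ m * (∏ p ∈ S, localFactor Ψ p ^ (m + 1)) /
              ((∏ p ∈ Q, p : ℕ) : ℝ)

/-- **C = `CollisionFormFacts`**: (1) EXPLICIT degenerate count — for non-degenerate `Ψ` the shifts `H ∈ [-2N,2N]^m`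
with `Ψ^{(H)}` degenerate number `≤ m(m+1)t² (4N+1)^{m-1}` (the landed `stub_degenerateCount` with its constant
exposed); (2) the collision forms `Δ_{j,j',i,i'}(H)`, `j ≠ j'`, of a NON-DEGENERATE translate-constellation are
non-zero; (3) `|Δ_{j,j',i,i'}(H)| ≤ 6 L² N` for `‖Ψ‖_N ≤ L`, `N ≥ 1`, `H` in the shift box. (References in the module docstring.) -/
def CollisionFormFacts : Prop :=
  (∀ (m t N : ℕ) (Ψ : Fin t → AffLinForm 1), IsNondegenerateSystem Ψ →
      (((shiftBox m N).filter (fun H => ¬ IsNondegenerateSystem (translateFamily Ψ H))).card : ℝ) ≤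
        (m : ℝ) * (m + 1) * (t : ℝ) ^ 2 * ((4 * N + 1 : ℕ) : ℝ) ^ (m - 1)) ∧
  (∀ (m t : ℕ) (Ψ : Fin t → AffLinForm 1) (H : Fin m → ℤ), IsNondegenerateSystem (translateFamily Ψ H) →
      ∀ (j j' : Fin (m + 1)) (i i' : Fin t), j ≠ j' → collisionForm Ψ H j j' i i' ≠ 0) ∧
  (∀ (m t N L : ℕ) (Ψ : Fin t → AffLinForm 1) (H : Fin m → ℤ), 1 ≤ N → affLinSize Ψ N ≤ L →
      H ∈ shiftBox m N → ∀ (j j' : Fin (m + 1)) (i i' : Fin t),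
        ((collisionForm Ψ H j j' i i').natAbs : ℝ) ≤ 6 * (L : ℝ) ^ 2 * N)

/-- **D1 = `MediumCollisions`** (square-free collision moduli `q ≤ √N`): for a non-negative weight `w` on the shift box,
`2`-Lipschitz in each shift, and any truncation `x`, with `y = truncLevel N`, `F(H) = ∏_{p ≤ y} β_p(Ψ^{(H)})`,
`F₀ = ∏_{p ≤ y} β_p(Ψ)`, `T = (m+1)t`:
`∑_{H nondeg} w F ∑_{∅ ≠ Q ⊆ primes(y,x], ∏Q ≤ √N} ∏_{p ∈ Q} collisionCount(H,p)/(p − T) ≤ η F₀^{m+1} (∑_{box} w + N^m N^{3/4})`,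
uniformly for `(m+1)t ≤ (log log N)^A`. (Per `Q`: expand the collision counts over assignments `α`, extend to the whole
box, cubes of side `primorial(y)·∏Q ≤ N` with `CondLocalAverage` and the landed `shiftBox_sum_mul_sub_le`; then sum over `Q`
with `∏_{p > y}(1 + T²/(p(p−T))) − 1 ≤ 4T²/y` and `∏_{p ≤ √N}(1 + T²/(p−T)) ≤ exp(T²(log log N + 4))` (Mertens).) (References in the module docstring.) -/
def MediumCollisions : Prop :=
  ∀ (t L A : ℕ), 1 ≤ t → ∀ η : ℝ, 0 < η → ∃ N₀ : ℕ, ∀ N : ℕ, N₀ ≤ N → ∀ m : ℕ,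
    (((m + 1) * t : ℕ) : ℝ) ≤ Real.log (Real.log N) ^ A →
    ∀ Ψ : Fin t → AffLinForm 1, IsNondegenerateSystem Ψ → affLinSize Ψ N ≤ L →
      ∀ w : (Fin m → ℤ) → ℝ, (∀ H, 0 ≤ w H) →
        (∀ H H' : Fin m → ℤ, |w H - w H'| ≤ 2 * ∑ j, |((H j : ℤ) : ℝ) - (H' j : ℝ)|) →
        (∀ H, H ∉ shiftBox m N → w H = 0) → ∀ x : ℕ,
          ∑ H ∈ (shiftBox m N).filter (fun H => IsNondegenerateSystem (translateFamily Ψ H)),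
              w H * singularProductPartial (translateFamily Ψ H) (truncLevel N) *
                ∑ Q ∈ ((primeWindow (truncLevel N) x).powerset).filter
                    (fun Q => Q.Nonempty ∧ ∏ p ∈ Q, p ≤ Nat.sqrt N),
                  ∏ p ∈ Q, (collisionCount Ψ H p : ℝ) / ((p : ℝ) - ((m + 1) * t : ℕ)) ≤
            η * singularProductPartial Ψ (truncLevel N) ^ (m + 1) *
              (∑ H ∈ shiftBox m N, w H + (N : ℝ) ^ m * (N : ℝ) ^ (3 / 4 : ℝ))

/-- **D2 = `TailCollisions`** (collision moduli `q > √N`, pointwise in a non-degenerate shift):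
`∑_{Q ⊆ primes(y,x], ∏Q > √N} ∏_{p ∈ Q} collisionCount(H,p)/(p − T) ≤ η` uniformly for `(m+1)t ≤ (log log N)^A`
(Rankin with exponent `1/2`: the sum is `≤ N^{-1/4} ∏_{p}(1 + 2 collisionCount(H,p)/√p)` and
`∑_p collisionCount(H,p) ≤ (m+1)² t² log(6L²N)/log y`, each prime `> y`). (References in the module docstring.) -/
def TailCollisions : Prop :=
  ∀ (t L A : ℕ), 1 ≤ t → ∀ η : ℝ, 0 < η → ∃ N₀ : ℕ, ∀ N : ℕ, N₀ ≤ N → ∀ m : ℕ,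
    (((m + 1) * t : ℕ) : ℝ) ≤ Real.log (Real.log N) ^ A →
    ∀ Ψ : Fin t → AffLinForm 1, IsNondegenerateSystem Ψ → affLinSize Ψ N ≤ L →
      ∀ H ∈ shiftBox m N, IsNondegenerateSystem (translateFamily Ψ H) → ∀ x : ℕ,
        ∑ Q ∈ ((primeWindow (truncLevel N) x).powerset).filter (fun Q => Nat.sqrt N < ∏ p ∈ Q, p),
            ∏ p ∈ Q, (collisionCount Ψ H p : ℝ) / ((p : ℝ) - ((m + 1) * t : ℕ)) ≤ η

/-- **E = `UniformSingularMeanGlue`**: the local ratio facts, the collision-form facts and the two collision estimates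
give the m-uniform Gallagher average (at a finite truncation `x ≥ y`:
`∏_{y<p≤x} β_p(Ψ^{(H)}) = (∏_{y<p≤x} β_p(Ψ))^{m+1} · R · ∏_p (1 + d_p(H)/(p−(m+1)ν_p))` with `1 − 2T²/y ≤ R ≤ 1` and
`0 ≤ d_p ≤ collisionCount`; the `Q = ∅` term is the landed cube/`LocalAverage` computation; then `x → ∞`). (References in the module docstring.) -/
def UniformSingularMeanGlue : Prop :=
  LocalRatioFacts → CollisionFormFacts → MediumCollisions → TailCollisions → UniformSingularMean

/-- **F = `Amplification`** (the tensor-power trick with `m + 1 = ⌈(log log N)^{t-1}⌉` translates): low mass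
`β_∞𝔖 < 5N` is `UniformRelativeDimOne` at dimension `t`; at high mass, `S^{m+1} = ∑_H S(Ψ^{(H)}, K_H)` (`completeSum`),
S⁺ at dimension `T = (m+1)t ≤ (log log N)^t` on the non-degenerate shifts, `UniformSingularMean` for their main terms,
the explicit degenerate count with the trivial bound `S_H ≤ (2N+1) log^T(5LN)`, give `(1−θ)M^{m+1} ≤ S^{m+1} ≤ (1+θ)M^{m+1}`,
whence `|S − M| ≤ 2θM/(m+1) ≤ 8θ C_𝔖 N` by the landed mass bound `𝔖 ≤ C_𝔖 (log log N)^{t-1}`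
(`AbsoluteUpgrade.stub_singularProduct_le_loglog_pow`). (References in the module docstring.) -/
def Amplification : Prop :=
  UniformSingularMean → CollisionFormFacts → UniformRelativeDimOne → DimOne

end Summit.Parity.GeneralizedHardyLittlewood.Cruxes.AbsoluteUpgrade.UniformAmplification

end
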